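/-
Copyright (c) 2026 the pub-hodgecm-mathlib formalisation cell (harness21).  Prover seat hodgecm-mathlib-LH5-p02 (g3): line LH3 (closer stub `stub_N9`, organ J),
brick (M-UNFOLD) (u2) (LH3-plan (g3) deal 2026-09-02T07:54:09Z).
-/
import Literature.NumberTheory.Automorphic.ArchInnerFormCartanAtlasCentralizer   -- ★ `exists_eq_gprimeCptGL_of_commute`, `exists_eq_gprimeSplitGL_of_commute`, `gprimeTorus_mem_centralizer`; brings the atlas (`gprimeTorus`, `gprimeBlock`, `archPiEquivCM`)
import Literature.NumberTheory.Automorphic.ArchInnerFormChartMeasures            -- ★ `chartTorusG`, `gprimeTorusHom`, `gprimeTorus_mem_chartTorusG`, `chartTorusG_mul_comm`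
import Literature.NumberTheory.Automorphic.ArchLocalSplitSingularCentralizer      -- ★ (V9) `exists_centralizer_continuousMulEquiv_of_splitSingular`, `centralizer_circleDiagonal_eq_range_endoEmb`, `circleDiagonal_eq_endoEmb`
import Literature.NumberTheory.Automorphic.ArchLocalRelabelTransport             -- ★ the relabelling iso `e_σ : G_w(α ∘ σ) ≃ₜ* G_w(α)`, `relabel_circleDiagonal`
import HarnessLib

/-!
# The centraliser of a SEMI-REGULAR chart point of the inner form `G′_∞`: block decomposition `Z(gprimeTorus α S′ p) ≃ₜ* U(σ diag(α_{τ0}, α_{τ2}))(ℂ) × K`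
# with the chart torus going to `(unit diagonal torus) × K` ((M-UNFOLD) (u2); Rogawski 1990 §4.12, §8.2 p. 122 «`Z(γ₀) ≅ U(1,1) × U(1)`»; Cassels–Fröhlich–free)

Topic `NumberTheory/Automorphic`; namespace `Literature.NumberTheory.Automorphic.UnitaryGroup`.  THEOREMS ONLY (no `def`, no instance, no notation, no axiom, no named fact,
no `sorry`).  Cell `pub/hodgecm-mathlib`, crux H413 (`stmt-HodgeConjecture-24833`), F0∕P3c line LH3 (closer stub `stub_N9`, organ J), brick **(M-UNFOLD) (u2)** = the
GROUP-THEORETIC half of the unfolding of the descended orbital functional of ★ D4b `exists_descended_chartOrbG_eq` (`∫_{M′ ⧸ T′} descConj … (a′)_M d(νM ∕ νT′)`,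
`M′ = Z(gprimeTorus α S′ p)`, `T′ = chartTorusG S′ ∩ M′`) at a SEMI-REGULAR point `p` (regular at every place `w ≠ w₀`; at the compact-chart place `w₀ ∉ S′` a wall
`e^{i p_{w₀,0}} = e^{i p_{w₀,2}} ≠ e^{i p_{w₀,1}}`).  The measure half is (u1) = ★ `InvariantQuotientProd` ∕ ★ `InvariantQuotientPiTopFactor(Map)` (consumers (J-G′-BLOCK)
F0P3-p02, (G′-CAY), (NONDEG-G′)).

THE MATHEMATICS.  Write `G′_∞ = Π_w G′_w` (★ `archPiEquivCM`), `τ₀ = lineOf (formSign α w₀)` the slot order at `w₀`, and `B := U(σ_{w₀} diag(α (τ₀ 0), α (τ₀ 2)))(ℂ)`,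
`U₁ := U(σ_{w₀} α (τ₀ 1))(ℂ)`.  The `w₀`-component of the wall point is `gprimeCptGL τ₀ (p w₀) = e_{τ₀}(diag z₀)`, `z₀ k = e^{i p_{w₀,k}}`, the RELABEL (★ `e_σ`, `σ = τ₀`) of the
standard `{0,2}∣{1}` split-singular pattern in `G_{w₀}(α ∘ τ₀)`, whose centraliser is the endoscopic block group `ι(B × U₁)` (★ (V9)); at `w ≠ w₀` the components of `p` are regular, so
the centraliser there is the chart torus component (★ `exists_eq_gprimeCptGL_of_commute` ∕ `exists_eq_gprimeSplitGL_of_commute`).  Hence the block projection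
`π : M′ →* B × U₁` (through ★ `archPiEquivCM`, `e_{τ₀}⁻¹` and (V9)), the block embedding `s : B →* M′` (`b ↦ (e_{τ₀} ι(b, 1))` at `w₀`, `1` elsewhere), `π_B ∘ s = id`, and with
`K := ker π_B` (CLOSED; `= ι(1 × U₁)_{w₀} × Π_{w ≠ w₀} T_w` as a set, so `K ≤ T′`, `K` commutative) the map **`e_M g = (π_B g, s(π_B g)⁻¹ g)`, `e_M⁻¹(b, k) = s(b) k`** is an
isomorphism of topological groups `M′ ≃ₜ* B × K` (`s(B)` commutes with `K`: ★ `commute_endoEmb_inl_inr` at `w₀`, trivially elsewhere).  Torus bookkeeping: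
`π_B (gprimeTorus α S′ c) = diag(e^{i c_{w₀,0}}, e^{i c_{w₀,2}})` and **`g ∈ T′ ↔ π_B g` is a unit diagonal**, i.e. `e_M(T′) = A × K` with `A` the unit-diagonal torus of `B` —
the `H₁.prod H₂` ∕ top-factor input of (u1); the quotient `M′ ⧸ T′ ≅ B ⧸ A` is the rank-one quotient on which (K0±) (★ `ArchRankOneJumpZero`, any `S ≤ GL₂(ℂ)` containing the
unit diagonals — here `S = archLocal L 2 (diagonal ![α (τ₀ 0), α (τ₀ 2)]) w₀`) and (A0-b) act.

* §1 local lemmas: `gprimeBlock_eq_relabel_circleDiagonal` (the wall component is the relabelled standard pattern), `commute_gprimeTorus_iff_forall` (commuting with a chart point is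
  checked place by place), `exists_coe_eq_gprimeBlock_of_commute_of_ne` (regular places), `circleDiagonal_two_comm_of_eq` (`diag(z,z)` is central in `GL₂`).
* §1 (cont.) `gprimeBlock_congr_place`, `exists_coe_eq_circleDiagonal_one_of_mem` (a `1 × 1` unitary matrix is `(e^{iθ})`).
* §2 **`exists_continuousMulEquiv_centralizer_gprimeTorus_semireg`** — the block decomposition with all the bookkeeping clauses: closed `K ≤ T′`; `K` commutative;
  `g ∈ T′ ↔` the `B`-component of `e_M g` is a unit diagonal; the `B`-component of `e_M(gprimeTorus α S′ c)` is `diag(e^{i c_{w₀,0}}, e^{i c_{w₀,2}})` and its `K`-component is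
  the chart point `gprimeTorus α S′ (update c w₀ (0, c_{w₀,1}, 0))` (so along the normal `c = p + ν • hcNrm w₀ 0 2` the `K`-component is CONSTANT — the `(γB ν, r₀)` binder of
  ★ `ArchChartOrbGBlockReduction`); and the subgroup equation `e_M(T′) = A.prod ⊤`, `A = range (circleDiagonal 2)` in `B`.
HONEST LABEL: HC_CM is proved only modulo the 7 printed citations (2 remaining named inputs: hLiu418 = `stmt-HodgeConjecture-24832`, h413 = `stmt-HodgeConjecture-24833`) until
rung 0 closes; count-neutral group-theoretic bookkeeping under organ J of `stub_N9`.

## References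
* [Rogawski1990] J. D. Rogawski, *Automorphic Representations of Unitary Groups in Three Variables*, Ann. of Math. Stud. 123 (1990), §8.2 p. 122 («`γ₀ = γ(θ, φ, 0)` … whose
  centralizer is `H ≅ U(1,1) × U(1)`»), §4.12 (descent to the centraliser), §4.8 Case (a) p. 53 (the block subgroup), §3.6 p. 31.
* [Knapp1986] A. W. Knapp, *Representation Theory of Semisimple Groups* (1986), Ch. V §3 (Cartan subgroups of `SU(2,1)`).
* [PlatonovRapinchuk1994] V. Platonov, A. Rapinchuk, *Algebraic Groups and Number Theory* (1994), §2.3 (unitary groups of hermitian forms, block subgroups).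
-/

set_option autoImplicit false

noncomputable section

open NumberField NumberField.InfinitePlace Matrix Complex Topology
open Literature.NumberTheory.Rogawski1990 Literature.LinearAlgebra.Matrix
open scoped MatrixGroups Matrix ComplexConjugate Classical

namespace Literature.NumberTheory.Automorphic.UnitaryGroup

/-! ## §1 Local lemmas -/

section Local

variable (L : Type) [Field L] [NumberField L] [IsCMField L] (α : Fin 3 → L)
  (S' : Finset {w : InfinitePlace L // IsComplex w}) (w₀ : {w : InfinitePlace L // IsComplex w})

omit [NumberField L] [IsCMField L] in
/-- **The compact-chart component at `w₀ ∉ S′` is the relabelled standard diagonal**: `gprimeBlock α w₀ S′ c = e_{τ₀} (diag (e^{i c_{w₀,k}})_k)`, `τ₀ = lineOf (formSign α w₀)`,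
`e_{τ₀} : G_{w₀}(α ∘ τ₀) ≃ₜ* G_{w₀}(α)` the relabelling isomorphism (★ `relabel_circleDiagonal`). [cite: Rogawski1990, §3.6 p. 31] -/
theorem gprimeBlock_eq_relabel_circleDiagonal {S' w₀} (hw₀ : w₀ ∉ S') (c : {w : InfinitePlace L // IsComplex w} → Fin 3 → ℝ) :
    gprimeBlock L α w₀ S' c =
      (ContinuousMulEquiv.restrictSubgroup (GLn.conjEquiv (Matrix.GeneralLinearGroup.mkOfDetNeZero _ (det_monomial_one_ne_zero 3 (lineOf (formSign L α w₀)))))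
          (archLocal L 3 (Matrix.diagonal (α ∘ (lineOf (formSign L α w₀)))) w₀) (archLocal L 3 (Matrix.diagonal α) w₀)
          (mem_archLocal_comp_perm_iff_conj_mem L 3 α w₀ (lineOf (formSign L α w₀))))
        ⟨circleDiagonal 3 (fun k => Circle.exp (c w₀ k)), circleDiagonal_mem_archLocal_diagonal L 3 (α ∘ (lineOf (formSign L α w₀))) w₀ _⟩ := by
  rw [relabel_circleDiagonal]
  apply Subtype.ext
  rw [coe_gprimeBlock_of_not_mem L α c hw₀]
  rfl

omit [NumberField L] [IsCMField L] in
/-- The chart component at `w` only reads the coordinates `c w`. [cite: Rogawski1990, §3.6 p. 31] -/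
theorem gprimeBlock_congr_place {c c' : {w : InfinitePlace L // IsComplex w} → Fin 3 → ℝ} (w : {w : InfinitePlace L // IsComplex w}) (h : c w = c' w) :
    gprimeBlock L α w S' c = gprimeBlock L α w S' c' := by
  apply Subtype.ext
  by_cases hw : w ∈ S'
  · by_cases hsp : w ∈ splitChartPlaces L α
    · rw [coe_gprimeBlock_of_mem L α c hw hsp, coe_gprimeBlock_of_mem L α c' hw hsp, h]
    · rw [coe_gprimeBlock_of_not_mem_splitChartPlaces L α c hsp, coe_gprimeBlock_of_not_mem_splitChartPlaces L α c' hsp, h]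
  · rw [coe_gprimeBlock_of_not_mem L α c hw, coe_gprimeBlock_of_not_mem L α c' hw, h]

/-- **Commuting with a chart point is checked place by place** through ★ `archPiEquivCM`. [cite: Rogawski1990, §3.6 p. 31] -/
theorem commute_gprimeTorus_iff_forall (c : {w : InfinitePlace L // IsComplex w} → Fin 3 → ℝ)
    (g : ↥(arch (↥(maximalRealSubfield L)) L (IsCMField.complexConj L) 3 (Matrix.diagonal α))) :
    g * gprimeTorus L α S' c = gprimeTorus L α S' c * g ↔
      ∀ w, archPiEquivCM 3 L (Matrix.diagonal α) g w * gprimeBlock L α w S' c = gprimeBlock L α w S' c * archPiEquivCM 3 L (Matrix.diagonal α) g w := by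
  constructor
  · intro h w
    have hw := congrArg (fun x : ↥(arch (↥(maximalRealSubfield L)) L (IsCMField.complexConj L) 3 (Matrix.diagonal α)) => archPiEquivCM 3 L (Matrix.diagonal α) x w) h
    simpa only [map_mul, Pi.mul_apply, archPiEquivCM_gprimeTorus] using hw
  · intro h
    apply (archPiEquivCM 3 L (Matrix.diagonal α)).injective
    funext w
    simpa only [map_mul, Pi.mul_apply, archPiEquivCM_gprimeTorus] using h w

omit [NumberField L] [IsCMField L] in
/-- **At a place where the chart point is regular, whatever commutes with its component is a chart component** (★ `exists_eq_gprimeCptGL_of_commute` off `S′`,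
★ `exists_eq_gprimeSplitGL_of_commute` on `S′`). [cite: Rogawski1990, §3.1 p. 19; §3.6 p. 31] -/
theorem exists_coe_eq_gprimeBlock_of_commute (hα : ∀ i, α i ≠ 0) (hS' : ∀ w, w ∈ S' → w ∈ splitChartPlaces L α)
    (p : {w : InfinitePlace L // IsComplex w} → Fin 3 → ℝ) (w : {w : InfinitePlace L // IsComplex w})
    (hreg : w ∉ S' → Function.Injective fun i : Fin 3 => Circle.exp (p w i)) (hregS : w ∈ S' → p w 0 ≠ 0)
    (y : ↥(archLocal L 3 (Matrix.diagonal α) w)) (hy : y * gprimeBlock L α w S' p = gprimeBlock L α w S' p * y) :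
    ∃ cw : Fin 3 → ℝ, (y : GL (Fin 3) ℂ) = ((gprimeBlock L α w S' (fun _ => cw) : ↥(archLocal L 3 (Matrix.diagonal α) w)) : GL (Fin 3) ℂ) := by
  have hy' := congrArg (fun x : ↥(archLocal L 3 (Matrix.diagonal α) w) => (x : GL (Fin 3) ℂ)) hy
  simp only [Subgroup.coe_mul] at hy'
  by_cases hw : w ∈ S'
  · rw [coe_gprimeBlock_of_mem L α p hw (hS' w hw)] at hy'
    obtain ⟨cw, h⟩ := exists_eq_gprimeSplitGL_of_commute L α hα (hS' w hw) (hregS hw) _ hy'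
    exact ⟨cw, by rw [h, coe_gprimeBlock_of_mem L α _ hw (hS' w hw)]⟩
  · rw [coe_gprimeBlock_of_not_mem L α p hw] at hy'
    obtain ⟨cw, h⟩ := exists_eq_gprimeCptGL_of_commute L α hα _ (hreg hw) _ hy'
    exact ⟨cw, by rw [h, coe_gprimeBlock_of_not_mem L α _ hw]⟩

omit [NumberField L] [IsCMField L] in
/-- `diag(z, z) = z · 1` is central in `GL₂(ℂ)`. [cite: PlatonovRapinchuk1994, §2.3] -/
theorem circleDiagonal_two_comm_of_eq {u : Fin 2 → Circle} (hu : u 0 = u 1) (g : GL (Fin 2) ℂ) :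
    g * circleDiagonal 2 u = circleDiagonal 2 u * g := by
  apply Units.ext
  have hd : ((circleDiagonal 2 u : GL (Fin 2) ℂ) : Matrix (Fin 2) (Fin 2) ℂ) = (u 0 : ℂ) • (1 : Matrix (Fin 2) (Fin 2) ℂ) := by
    rw [coe_circleDiagonal]
    ext i j
    fin_cases i <;> fin_cases j <;> simp [Matrix.diagonal, hu]
  rw [Units.val_mul, Units.val_mul, hd, Matrix.mul_smul, Matrix.smul_mul, Matrix.mul_one, Matrix.one_mul]


omit [NumberField L] [IsCMField L] in
/-- **A `1 × 1` unitary matrix is a unit scalar**: for `u ∈ U(σ_w a)(ℂ)` (`a ≠ 0`), `u = (e^{iθ})` for some real `θ`. [cite: PlatonovRapinchuk1994, §2.3] -/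
theorem exists_coe_eq_circleDiagonal_one_of_mem {a : L} (ha : a ≠ 0) (w : {w : InfinitePlace L // IsComplex w})
    (u : ↥(unitaryGroupOfForm (starRingEnd ℂ) ((Matrix.diagonal ![a]).map w.1.embedding))) :
    ∃ θ : ℝ, ((u : GL (Fin 1) ℂ) : Matrix (Fin 1) (Fin 1) ℂ) = Matrix.diagonal fun _ => Complex.exp ((θ : ℂ) * I) := by
  have hU : ((u : GL (Fin 1) ℂ) : Matrix (Fin 1) (Fin 1) ℂ)ᴴ * (Matrix.diagonal ![a]).map w.1.embedding * ((u : GL (Fin 1) ℂ) : Matrix (Fin 1) (Fin 1) ℂ) =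
      (Matrix.diagonal ![a]).map w.1.embedding :=
    (mem_archLocal_iff_conjTranspose L 1 (Matrix.diagonal ![a]) w (u : GL (Fin 1) ℂ)).1 u.2
  set G := ((u : GL (Fin 1) ℂ) : Matrix (Fin 1) (Fin 1) ℂ) with hG
  have ha' : w.1.embedding a ≠ 0 := (map_ne_zero _).2 ha
  have h00 := congrFun (congrFun hU 0) 0
  rw [Matrix.diagonal_map (map_zero _)] at h00
  simp only [Matrix.mul_apply, Fin.sum_univ_one, Matrix.conjTranspose_apply, Matrix.diagonal_apply_eq,
    Matrix.cons_val_zero, RCLike.star_def] at h00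
  -- `conj (G 0 0) * σ a * G 0 0 = σ a` ⇒ `‖G 0 0‖ = 1`
  have hnorm : ‖G 0 0‖ = 1 := by
    have h1 : (starRingEnd ℂ) (G 0 0) * G 0 0 = 1 := by
      have h2 : ((starRingEnd ℂ) (G 0 0) * G 0 0 - 1) * w.1.embedding a = 0 := by
        linear_combination h00
      rcases mul_eq_zero.1 h2 with h3 | h3
      · exact sub_eq_zero.1 h3
      · exact absurd h3 ha'
    have h4 : (Complex.normSq (G 0 0) : ℂ) = 1 := by rw [Complex.normSq_eq_conj_mul_self]; exact h1
    have h5 : Complex.normSq (G 0 0) = 1 := by exact_mod_cast h4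
    have h6 : ‖G 0 0‖ ^ 2 = 1 := by rw [← Complex.normSq_eq_norm_sq]; exact h5
    nlinarith [norm_nonneg (G 0 0)]
  refine ⟨Complex.arg (G 0 0), ?_⟩
  have hpolar : G 0 0 = Complex.exp ((Complex.arg (G 0 0) : ℂ) * I) := by
    have h := Complex.norm_mul_exp_arg_mul_I (G 0 0)
    rw [hnorm, Complex.ofReal_one, one_mul] at h
    exact h.symm
  ext i j
  fin_cases i; fin_cases j
  rw [Matrix.diagonal_apply_eq]
  exact hpolar

/-! ## §2 The block decomposition of the centraliser of a semi-regular chart point -/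

set_option maxHeartbeats 800000 in
/-- **(M-UNFOLD) (u2): BLOCK DECOMPOSITION OF THE CENTRALISER OF A SEMI-REGULAR CHART POINT.**  House frame `diagonal α` (`α_i ≠ 0`), compact chart `S′` (`S′ ⊆` split-chart
places, `w₀ ∉ S′`), `p` regular at every `w ≠ w₀` and at the wall `e^{i p_{w₀,0}} = e^{i p_{w₀,2}} ≠ e^{i p_{w₀,1}}` at `w₀`; `M′ = Z(gprimeTorus α S′ p)`, `T′ = chartTorusG S′` (`≤ M′`),
`B = U(σ_{w₀} diag(α (τ₀ 0), α (τ₀ 2)))(ℂ)`, `τ₀ = lineOf (formSign α w₀)`.  THEN there are a CLOSED subgroup `K ≤ M′` and an isomorphism of topological groups **`e_M : M′ ≃ₜ* B × K`**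
such that: `K ≤ T′`; `K` is commutative; **`g ∈ T′ ↔` the `B`-component of `e_M g` is a unit diagonal**; the `B`-component of a chart point `gprimeTorus α S′ c` is
`diag(e^{i c_{w₀,0}}, e^{i c_{w₀,2}})`; and, as subgroups of `B × K`, `e_M(T′) = A × ⊤` with `A` the unit-diagonal torus of `B` — so `M′ ⧸ T′ ≅ B ⧸ A` (★ `InvariantQuotientProd`,
★ `InvariantQuotientPiTopFactor`), the rank-one quotient of (K0±) ∕ (A0-b).  (`e_M g = (π_B g, s_B(π_B g)⁻¹ g)` with `π_B` the block projection through ★ `archPiEquivCM`, the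
relabelling `e_{τ₀}` and ★ (V9), `s_B` the block embedding, `K = ker π_B`.) [cite: Rogawski1990, §8.2 p. 122; §4.12; §4.8 Case (a) p. 53] [cite: Knapp1986, Ch. V §3] -/
theorem exists_continuousMulEquiv_centralizer_gprimeTorus_semireg (hα : ∀ i, α i ≠ 0) (hS' : ∀ w, w ∈ S' → w ∈ splitChartPlaces L α)
    (hw₀ : w₀ ∉ S') (p : {w : InfinitePlace L // IsComplex w} → Fin 3 → ℝ)
    (h02 : Circle.exp (p w₀ 0) = Circle.exp (p w₀ 2)) (h01 : Circle.exp (p w₀ 0) ≠ Circle.exp (p w₀ 1))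
    (hreg : ∀ w, w ≠ w₀ → w ∉ S' → Function.Injective fun i : Fin 3 => Circle.exp (p w i)) (hregS : ∀ w, w ∈ S' → p w 0 ≠ 0) :
    ∃ (K : Subgroup ↥(Subgroup.centralizer ({gprimeTorus L α S' p} : Set ↥(arch (↥(maximalRealSubfield L)) L (IsCMField.complexConj L) 3 (Matrix.diagonal α)))))
      (e : ↥(Subgroup.centralizer ({gprimeTorus L α S' p} : Set ↥(arch (↥(maximalRealSubfield L)) L (IsCMField.complexConj L) 3 (Matrix.diagonal α)))) ≃ₜ*
        ↥(unitaryGroupOfForm (starRingEnd ℂ) ((Matrix.diagonal ![α (lineOf (formSign L α w₀) 0), α (lineOf (formSign L α w₀) 2)]).map w₀.1.embedding)) × ↥K),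
      IsClosed (K : Set ↥(Subgroup.centralizer ({gprimeTorus L α S' p} : Set ↥(arch (↥(maximalRealSubfield L)) L (IsCMField.complexConj L) 3 (Matrix.diagonal α))))) ∧
      (∀ k : ↥(Subgroup.centralizer ({gprimeTorus L α S' p} : Set ↥(arch (↥(maximalRealSubfield L)) L (IsCMField.complexConj L) 3 (Matrix.diagonal α)))),
        k ∈ K → (k : ↥(arch (↥(maximalRealSubfield L)) L (IsCMField.complexConj L) 3 (Matrix.diagonal α))) ∈ chartTorusG L α S') ∧
      (∀ k₁, k₁ ∈ K → ∀ k₂, k₂ ∈ K → k₁ * k₂ = k₂ * k₁) ∧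
      (∀ g : ↥(Subgroup.centralizer ({gprimeTorus L α S' p} : Set ↥(arch (↥(maximalRealSubfield L)) L (IsCMField.complexConj L) 3 (Matrix.diagonal α)))),
        (g : ↥(arch (↥(maximalRealSubfield L)) L (IsCMField.complexConj L) 3 (Matrix.diagonal α))) ∈ chartTorusG L α S' ↔
        (((e g).1 : ↥(unitaryGroupOfForm (starRingEnd ℂ) ((Matrix.diagonal ![α (lineOf (formSign L α w₀) 0), α (lineOf (formSign L α w₀) 2)]).map w₀.1.embedding))) :
          GL (Fin 2) ℂ) ∈ Set.range (circleDiagonal 2)) ∧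
      (∀ c : {w : InfinitePlace L // IsComplex w} → Fin 3 → ℝ,
        (((e ⟨gprimeTorus L α S' c, gprimeTorus_mem_centralizer L α S' p c⟩).1 :
          ↥(unitaryGroupOfForm (starRingEnd ℂ) ((Matrix.diagonal ![α (lineOf (formSign L α w₀) 0), α (lineOf (formSign L α w₀) 2)]).map w₀.1.embedding))) : GL (Fin 2) ℂ) =
          circleDiagonal 2 ![Circle.exp (c w₀ 0), Circle.exp (c w₀ 2)]) ∧
      (∀ c : {w : InfinitePlace L // IsComplex w} → Fin 3 → ℝ,
        ((((e ⟨gprimeTorus L α S' c, gprimeTorus_mem_centralizer L α S' p c⟩).2 : ↥K) :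
          ↥(Subgroup.centralizer ({gprimeTorus L α S' p} : Set ↥(arch (↥(maximalRealSubfield L)) L (IsCMField.complexConj L) 3 (Matrix.diagonal α))))) :
            ↥(arch (↥(maximalRealSubfield L)) L (IsCMField.complexConj L) 3 (Matrix.diagonal α))) =
          gprimeTorus L α S' (Function.update c w₀ ![0, c w₀ 1, 0])) ∧
      Subgroup.map (e : ↥(Subgroup.centralizer ({gprimeTorus L α S' p} : Set ↥(arch (↥(maximalRealSubfield L)) L (IsCMField.complexConj L) 3 (Matrix.diagonal α)))) →*
          ↥(unitaryGroupOfForm (starRingEnd ℂ) ((Matrix.diagonal ![α (lineOf (formSign L α w₀) 0), α (lineOf (formSign L α w₀) 2)]).map w₀.1.embedding)) × ↥K)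
        ((chartTorusG L α S').subgroupOf (Subgroup.centralizer ({gprimeTorus L α S' p} : Set ↥(arch (↥(maximalRealSubfield L)) L (IsCMField.complexConj L) 3 (Matrix.diagonal α))))) =
        (((circleDiagonal 2).codRestrict (unitaryGroupOfForm (starRingEnd ℂ) ((Matrix.diagonal ![α (lineOf (formSign L α w₀) 0), α (lineOf (formSign L α w₀) 2)]).map w₀.1.embedding))
            (circleDiagonal_mem_archLocal_diagonal L 2 ![α (lineOf (formSign L α w₀) 0), α (lineOf (formSign L α w₀) 2)] w₀)).range).prod ⊤ := by
  classical
  -- §A  Notation: the ambient group, its place decomposition, the relabelling at `w₀`, the standard wall point `diag z₀` in `G_{w₀}(α ∘ τ₀)`.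
  let τ₀ : Fin 3 ≃ Fin 3 := lineOf (formSign L α w₀)
  let G := ↥(arch (↥(maximalRealSubfield L)) L (IsCMField.complexConj L) 3 (Matrix.diagonal α))
  let Φ := archPiEquivCM 3 L (Matrix.diagonal α)
  let eτ : ↥(unitaryGroupOfForm (starRingEnd ℂ) ((Matrix.diagonal (α ∘ τ₀)).map w₀.1.embedding)) ≃ₜ* ↥(archLocal L 3 (Matrix.diagonal α) w₀) :=
    ContinuousMulEquiv.restrictSubgroup (GLn.conjEquiv (Matrix.GeneralLinearGroup.mkOfDetNeZero _ (det_monomial_one_ne_zero 3 τ₀)))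
      (archLocal L 3 (Matrix.diagonal (α ∘ τ₀)) w₀) (archLocal L 3 (Matrix.diagonal α) w₀) (mem_archLocal_comp_perm_iff_conj_mem L 3 α w₀ τ₀)
  let z₀ : Fin 3 → Circle := fun k => Circle.exp (p w₀ k)
  let d₀ : ↥(unitaryGroupOfForm (starRingEnd ℂ) ((Matrix.diagonal (α ∘ τ₀)).map w₀.1.embedding)) :=
    ⟨circleDiagonal 3 z₀, circleDiagonal_mem_archLocal_diagonal L 3 (α ∘ τ₀) w₀ z₀⟩
  let ι := endoEmb (starRingEnd ℂ) ((Matrix.diagonal ![(α ∘ τ₀) 0, (α ∘ τ₀) 2]).map w₀.1.embedding) ((Matrix.diagonal ![(α ∘ τ₀) 1]).map w₀.1.embedding)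
      ((Matrix.diagonal (α ∘ τ₀)).map w₀.1.embedding) (endoForm_archLocal_diagonal L (α ∘ τ₀) w₀)
  let M' : Subgroup G := Subgroup.centralizer ({gprimeTorus L α S' p} : Set G)
  have hz02 : z₀ 0 = z₀ 2 := h02
  have hz01 : z₀ 0 ≠ z₀ 1 := h01
  -- ★ (V9) at `α ∘ τ₀`: the centraliser of the standard wall point is the block group, `e9⁻¹ = ι` on the nose.
  obtain ⟨e9, he9⟩ := exists_centralizer_continuousMulEquiv_of_splitSingular L (α ∘ τ₀) w₀ (z := z₀) hz02 hz01
  -- the wall component at `w₀`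
  have hwall : gprimeBlock L α w₀ S' p = eτ d₀ := by exact gprimeBlock_eq_relabel_circleDiagonal L α hw₀ p
  have hblk : ∀ c : {w : InfinitePlace L // IsComplex w} → Fin 3 → ℝ,
      gprimeBlock L α w₀ S' c = eτ ⟨circleDiagonal 3 (fun k => Circle.exp (c w₀ k)), circleDiagonal_mem_archLocal_diagonal L 3 (α ∘ τ₀) w₀ _⟩ :=
    fun c => by exact gprimeBlock_eq_relabel_circleDiagonal L α hw₀ c
  have hd₀ι : d₀ = ι (⟨circleDiagonal 2 ![z₀ 0, z₀ 2], (circleDiagonal_blocks_mem L (α ∘ τ₀) w₀ z₀).1⟩, ⟨circleDiagonal 1 ![z₀ 1], (circleDiagonal_blocks_mem L (α ∘ τ₀) w₀ z₀).2⟩) :=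
    circleDiagonal_eq_endoEmb L (α ∘ τ₀) w₀ z₀
  -- §B  The local component at `w₀`, read in `G_{w₀}(α ∘ τ₀)`: `ψ g = e_{τ₀}⁻¹ (g_{w₀})`, and it commutes with `d₀`.
  let ψ : ↥M' →* ↥(unitaryGroupOfForm (starRingEnd ℂ) ((Matrix.diagonal (α ∘ τ₀)).map w₀.1.embedding)) :=
    (eτ.symm : ↥(archLocal L 3 (Matrix.diagonal α) w₀) →* ↥(unitaryGroupOfForm (starRingEnd ℂ) ((Matrix.diagonal (α ∘ τ₀)).map w₀.1.embedding))).comp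
      ((Pi.evalMonoidHom (fun w : {w : InfinitePlace L // IsComplex w} => ↥(archLocal L 3 (Matrix.diagonal α) w)) w₀).comp
        ((Φ : G →* _).comp M'.subtype))
  have hψ_apply : ∀ g : ↥M', ψ g = eτ.symm (Φ (g : G) w₀) := fun g => rfl
  have hψ_mem : ∀ g : ↥M', ψ g ∈ Subgroup.centralizer ({d₀} : Set ↥(unitaryGroupOfForm (starRingEnd ℂ) ((Matrix.diagonal (α ∘ τ₀)).map w₀.1.embedding))) := by
    intro g
    rw [Subgroup.mem_centralizer_singleton_iff, hψ_apply]
    have hg : (g : G) * gprimeTorus L α S' p = gprimeTorus L α S' p * g := (Subgroup.mem_centralizer_singleton_iff.1 g.2)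
    have hg₀ := (commute_gprimeTorus_iff_forall L α S' p (g : G)).1 hg w₀
    rw [hwall] at hg₀
    have h := congrArg eτ.symm hg₀
    simpa only [map_mul, ContinuousMulEquiv.symm_apply_apply] using h
  let ψ' : ↥M' →* ↥(Subgroup.centralizer ({d₀} : Set ↥(unitaryGroupOfForm (starRingEnd ℂ) ((Matrix.diagonal (α ∘ τ₀)).map w₀.1.embedding)))) :=
    ψ.codRestrict _ hψ_mem
  -- the block projection `π = e9 ∘ ψ′ : M′ →* B × U₁` and `π_B`
  let π : ↥M' →* ↥(unitaryGroupOfForm (starRingEnd ℂ) ((Matrix.diagonal ![(α ∘ τ₀) 0, (α ∘ τ₀) 2]).map w₀.1.embedding)) ×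
      ↥(unitaryGroupOfForm (starRingEnd ℂ) ((Matrix.diagonal ![(α ∘ τ₀) 1]).map w₀.1.embedding)) :=
    (e9 : _ →* _).comp ψ'
  let πB := (MonoidHom.fst _ _).comp π
  have hπB_apply : ∀ g : ↥M', πB g = (π g).1 := fun _ => rfl
  -- KEY: `ι (π g) = ψ g`, i.e. the `w₀`-component of `g ∈ M′` is `e_{τ₀} (ι (π g))`.
  have hιπ : ∀ g : ↥M', ι (π g) = ψ g := by
    intro g
    have h1 : ((e9.symm (π g) : ↥(Subgroup.centralizer ({d₀} : Set _))) : ↥(unitaryGroupOfForm (starRingEnd ℂ) ((Matrix.diagonal (α ∘ τ₀)).map w₀.1.embedding))) = ι (π g) :=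
      he9 (π g)
    rw [← h1]
    show ((e9.symm (e9 (ψ' g)) : ↥(Subgroup.centralizer ({d₀} : Set _))) : _) = ψ g
    rw [ContinuousMulEquiv.symm_apply_apply]
    rfl
  have hcomp : ∀ g : ↥M', Φ (g : G) w₀ = eτ (ι (π g)) := by
    intro g
    rw [hιπ, hψ_apply, ContinuousMulEquiv.apply_symm_apply]
  -- §C  The block embedding `s_B : B →* M′`.
  let j : ↥(unitaryGroupOfForm (starRingEnd ℂ) ((Matrix.diagonal ![(α ∘ τ₀) 0, (α ∘ τ₀) 2]).map w₀.1.embedding)) →* G :=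
    (Φ.symm : _ →* G).comp
      ((MonoidHom.mulSingle (fun w : {w : InfinitePlace L // IsComplex w} => ↥(archLocal L 3 (Matrix.diagonal α) w)) w₀).comp
        ((eτ : ↥(unitaryGroupOfForm (starRingEnd ℂ) ((Matrix.diagonal (α ∘ τ₀)).map w₀.1.embedding)) →* ↥(archLocal L 3 (Matrix.diagonal α) w₀)).comp
          (ι.comp (MonoidHom.inl _ _))))
  have hj_apply : ∀ b, Φ (j b) = Pi.mulSingle w₀ (eτ (ι (b, 1))) := by
    intro b
    show Φ (Φ.symm (Pi.mulSingle w₀ (eτ (ι (b, 1))))) = _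
    rw [ContinuousMulEquiv.apply_symm_apply]
  have hj_w₀ : ∀ b, Φ (j b) w₀ = eτ (ι (b, 1)) := by
    intro b; rw [hj_apply, Pi.mulSingle_eq_same]
  have hj_ne : ∀ b, ∀ w, w ≠ w₀ → Φ (j b) w = 1 := by
    intro b w hw; rw [hj_apply, Pi.mulSingle_eq_of_ne hw]
  -- `b` commutes with the central `diag(z₀ 0, z₀ 2)` of `B`, so `ι(b, 1)` commutes with `d₀`
  have hb_comm : ∀ b : ↥(unitaryGroupOfForm (starRingEnd ℂ) ((Matrix.diagonal ![(α ∘ τ₀) 0, (α ∘ τ₀) 2]).map w₀.1.embedding)),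
      ι (b, 1) * d₀ = d₀ * ι (b, 1) := by
    intro b
    rw [hd₀ι, ← map_mul, ← map_mul, Prod.mk_mul_mk, Prod.mk_mul_mk, one_mul, mul_one]
    congr 2
    apply Subtype.ext
    exact circleDiagonal_two_comm_of_eq (u := ![z₀ 0, z₀ 2]) (by exact hz02) (b : GL (Fin 2) ℂ)
  have hj_mem : ∀ b, j b ∈ M' := by
    intro b
    rw [Subgroup.mem_centralizer_singleton_iff]
    refine (commute_gprimeTorus_iff_forall L α S' p (j b)).2 fun w => ?_
    by_cases hw : w = w₀
    · rw [hw, hj_w₀, hwall, ← map_mul, ← map_mul, hb_comm]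
    · rw [hj_ne b w hw, one_mul, mul_one]
  let sB : ↥(unitaryGroupOfForm (starRingEnd ℂ) ((Matrix.diagonal ![(α ∘ τ₀) 0, (α ∘ τ₀) 2]).map w₀.1.embedding)) →* ↥M' := j.codRestrict M' hj_mem
  have hsB_coe : ∀ b, ((sB b : ↥M') : G) = j b := fun b => rfl
  -- `π (s_B b) = (b, 1)`
  have hπsB : ∀ b, π (sB b) = (b, 1) := by
    intro b
    apply e9.symm.injective
    apply Subtype.ext
    rw [he9 (b, 1)]
    show ((e9.symm (e9 (ψ' (sB b))) : ↥(Subgroup.centralizer ({d₀} : Set _))) : _) = ι (b, 1)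
    rw [ContinuousMulEquiv.symm_apply_apply]
    show ψ (sB b) = ι (b, 1)
    rw [hψ_apply, hsB_coe, hj_w₀, ContinuousMulEquiv.symm_apply_apply]
  have hπBsB : ∀ b, πB (sB b) = b := by
    intro b; rw [hπB_apply, hπsB]
  -- §D  `s_B(b)` commutes with every `k ∈ ker π_B`.
  have hcommK : ∀ b, ∀ k : ↥M', πB k = 1 → sB b * k = k * sB b := by
    intro b k hk
    apply Subtype.ext
    apply Φ.injective
    funext w
    show Φ (((sB b : ↥M') : G) * (k : G)) w = Φ ((k : G) * ((sB b : ↥M') : G)) w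
    rw [map_mul, map_mul, Pi.mul_apply, Pi.mul_apply, hsB_coe]
    by_cases hw : w = w₀
    · rw [hw, hj_w₀, hcomp k]
      have hk' : π k = (1, (π k).2) := Prod.ext (by rw [← hπB_apply]; exact hk) rfl
      have hc := (commute_endoEmb_inl_inr (starRingEnd ℂ) (endoForm_archLocal_diagonal L (α ∘ τ₀) w₀) b (π k).2).eq
      rw [hk', ← map_mul eτ, ← map_mul eτ, hc]
    · rw [hj_ne b w hw, one_mul, mul_one]
  -- §E  `K = ker π_B` and the isomorphism `e_M : M′ ≃ₜ* B × K`.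
  let K : Subgroup ↥M' := πB.ker
  have hK_mem : ∀ k : ↥M', k ∈ K ↔ πB k = 1 := fun k => MonoidHom.mem_ker
  have hsec : ∀ g : ↥M', (sB (πB g))⁻¹ * g ∈ K := by
    intro g; rw [hK_mem, map_mul, map_inv, hπBsB, inv_mul_cancel]
  have hπB_cont : Continuous πB := by
    have h1 : Continuous ψ := by
      show Continuous fun g : ↥M' => eτ.symm (Φ (g : G) w₀)
      exact eτ.symm.continuous.comp ((continuous_apply w₀).comp (Φ.continuous.comp continuous_subtype_val))
    have h2 : Continuous ψ' := h1.subtype_mk _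
    exact continuous_fst.comp (e9.continuous.comp h2)
  have hsB_cont : Continuous sB := by
    have h1 : Continuous j := by
      show Continuous fun b => Φ.symm (Pi.mulSingle w₀ (eτ (ι (b, 1))))
      exact Φ.symm.continuous.comp ((_root_.continuous_mulSingle w₀).comp (eτ.continuous.comp
        ((continuous_endoEmb (starRingEnd ℂ) (endoForm_archLocal_diagonal L (α ∘ τ₀) w₀)).comp (continuous_id.prodMk continuous_const))))
    exact h1.subtype_mk _
  let eM : ↥M' ≃* (↥(unitaryGroupOfForm (starRingEnd ℂ) ((Matrix.diagonal ![(α ∘ τ₀) 0, (α ∘ τ₀) 2]).map w₀.1.embedding)) × ↥K) :=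
    { toFun := fun g => (πB g, ⟨(sB (πB g))⁻¹ * g, hsec g⟩)
      invFun := fun q => sB q.1 * (q.2 : ↥M')
      left_inv := fun g => mul_inv_cancel_left _ _
      right_inv := fun q => by
        have h1 : πB (sB q.1 * (q.2 : ↥M')) = q.1 := by rw [map_mul, hπBsB, (hK_mem _).1 q.2.2, mul_one]
        refine Prod.ext h1 (Subtype.ext ?_)
        show (sB (πB (sB q.1 * (q.2 : ↥M'))))⁻¹ * (sB q.1 * (q.2 : ↥M')) = (q.2 : ↥M')
        rw [h1, inv_mul_cancel_left]
      map_mul' := fun g h => by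
        refine Prod.ext (map_mul πB g h) (Subtype.ext ?_)
        show (sB (πB (g * h)))⁻¹ * (g * h) = ((sB (πB g))⁻¹ * g) * ((sB (πB h))⁻¹ * h)
        have hc : sB (πB h) * ((sB (πB g))⁻¹ * g) = ((sB (πB g))⁻¹ * g) * sB (πB h) := hcommK (πB h) _ ((hK_mem _).1 (hsec g))
        have hc' : (sB (πB h))⁻¹ * ((sB (πB g))⁻¹ * g) = ((sB (πB g))⁻¹ * g) * (sB (πB h))⁻¹ := by
          rw [inv_mul_eq_iff_eq_mul, ← mul_assoc, hc, mul_inv_cancel_right]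
        rw [map_mul, map_mul, _root_.mul_inv_rev]
        calc (sB (πB h))⁻¹ * (sB (πB g))⁻¹ * (g * h)
            = ((sB (πB h))⁻¹ * ((sB (πB g))⁻¹ * g)) * h := by simp only [mul_assoc]
          _ = (((sB (πB g))⁻¹ * g) * (sB (πB h))⁻¹) * h := by rw [hc']
          _ = (sB (πB g))⁻¹ * g * ((sB (πB h))⁻¹ * h) := by simp only [mul_assoc] }
  have heM_apply : ∀ g : ↥M', eM g = (πB g, ⟨(sB (πB g))⁻¹ * g, hsec g⟩) := fun _ => rfl
  have heM_cont : Continuous eM := by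
    show Continuous fun g : ↥M' => (πB g, (⟨(sB (πB g))⁻¹ * g, hsec g⟩ : ↥K))
    exact hπB_cont.prodMk (((hsB_cont.comp hπB_cont).inv.mul continuous_id).subtype_mk _)
  have heM_symm_cont : Continuous eM.symm := by
    show Continuous fun q : ↥(unitaryGroupOfForm (starRingEnd ℂ) ((Matrix.diagonal ![(α ∘ τ₀) 0, (α ∘ τ₀) 2]).map w₀.1.embedding)) × ↥K =>
      sB q.1 * (q.2 : ↥M')
    exact (hsB_cont.comp continuous_fst).mul (continuous_subtype_val.comp continuous_snd)
  let e : ↥M' ≃ₜ* (↥(unitaryGroupOfForm (starRingEnd ℂ) ((Matrix.diagonal ![(α ∘ τ₀) 0, (α ∘ τ₀) 2]).map w₀.1.embedding)) × ↥K) :=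
    { eM with continuous_toFun := heM_cont, continuous_invFun := heM_symm_cont }
  have he_fst : ∀ g : ↥M', (e g).1 = πB g := fun _ => rfl
  -- §F  Torus bookkeeping.
  have hΦγ : ∀ c w, Φ (gprimeTorus L α S' c) w = gprimeBlock L α w S' c := fun c w => archPiEquivCM_gprimeTorus L α S' c w
  -- a product of chart components is a chart point, hence lies in `T′`
  have mem_T_of_local : ∀ x : G, (∀ w, ∃ cw : Fin 3 → ℝ, ((Φ x w : ↥(archLocal L 3 (Matrix.diagonal α) w)) : GL (Fin 3) ℂ) =
      ((gprimeBlock L α w S' (fun _ => cw) : ↥(archLocal L 3 (Matrix.diagonal α) w)) : GL (Fin 3) ℂ)) → x ∈ chartTorusG L α S' := by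
    intro x hx
    choose c' hc' using hx
    have hxeq : x = gprimeTorus L α S' (fun w => c' w) := by
      apply Φ.injective
      funext w
      apply Subtype.ext
      rw [hc' w, hΦγ]
      rfl
    rw [hxeq]
    exact gprimeTorus_mem_chartTorusG L α S' _
  -- the block of a chart point
  have htorus : ∀ c, π ⟨gprimeTorus L α S' c, gprimeTorus_mem_centralizer L α S' p c⟩ =
      (⟨circleDiagonal 2 ![Circle.exp (c w₀ 0), Circle.exp (c w₀ 2)], (circleDiagonal_blocks_mem L (α ∘ τ₀) w₀ (fun k => Circle.exp (c w₀ k))).1⟩,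
       ⟨circleDiagonal 1 ![Circle.exp (c w₀ 1)], (circleDiagonal_blocks_mem L (α ∘ τ₀) w₀ (fun k => Circle.exp (c w₀ k))).2⟩) := by
    intro c
    apply e9.symm.injective
    apply Subtype.ext
    rw [he9, he9, hιπ, hψ_apply, ← circleDiagonal_eq_endoEmb L (α ∘ τ₀) w₀ (fun k => Circle.exp (c w₀ k))]
    show eτ.symm (Φ (gprimeTorus L α S' c) w₀) = _
    rw [hΦγ, gprimeBlock_eq_relabel_circleDiagonal L α hw₀ c]
    exact ContinuousMulEquiv.symm_apply_apply eτ _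
  -- elements of `K` are chart points: `K ≤ T′`
  have hKT : ∀ k : ↥M', k ∈ K → (k : G) ∈ chartTorusG L α S' := by
    intro k hk
    have hk1 : πB k = 1 := (hK_mem k).1 hk
    have hkw := (commute_gprimeTorus_iff_forall L α S' p (k : G)).1 (Subgroup.mem_centralizer_singleton_iff.1 k.2)
    obtain ⟨θ, hθ⟩ := exists_coe_eq_circleDiagonal_one_of_mem L (a := (α ∘ τ₀) 1) (hα _) w₀ (π k).2
    refine mem_T_of_local (k : G) fun w => ?_
    by_cases hw : w = w₀
    · refine ⟨![0, θ, 0], ?_⟩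
      have hk' : π k = (1, (π k).2) := Prod.ext (by rw [← hπB_apply]; exact hk1) rfl
      have hz : ι (1, (π k).2) =
          ⟨circleDiagonal 3 (fun i => Circle.exp ((![0, θ, 0] : Fin 3 → ℝ) i)), circleDiagonal_mem_archLocal_diagonal L 3 (α ∘ τ₀) w₀ _⟩ := by
        rw [circleDiagonal_eq_endoEmb L (α ∘ τ₀) w₀ (fun i => Circle.exp ((![0, θ, 0] : Fin 3 → ℝ) i))]
        congr 1
        refine Prod.ext (Subtype.ext ?_) (Subtype.ext ?_)
        · show ((1 : ↥(unitaryGroupOfForm (starRingEnd ℂ) ((Matrix.diagonal ![(α ∘ τ₀) 0, (α ∘ τ₀) 2]).map w₀.1.embedding))) : GL (Fin 2) ℂ) =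
            circleDiagonal 2 ![Circle.exp ((![0, θ, 0] : Fin 3 → ℝ) 0), Circle.exp ((![0, θ, 0] : Fin 3 → ℝ) 2)]
          have h0 : (![0, θ, 0] : Fin 3 → ℝ) 0 = 0 := rfl
          have h2 : (![0, θ, 0] : Fin 3 → ℝ) 2 = 0 := rfl
          rw [h0, h2, Circle.exp_zero]
          have h11 : (![(1 : Circle), 1] : Fin 2 → Circle) = 1 := by funext i; fin_cases i <;> rfl
          rw [h11, map_one]
          rfl
        · show (((π k).2 : ↥(unitaryGroupOfForm (starRingEnd ℂ) ((Matrix.diagonal ![(α ∘ τ₀) 1]).map w₀.1.embedding))) : GL (Fin 1) ℂ) =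
            circleDiagonal 1 ![Circle.exp ((![0, θ, 0] : Fin 3 → ℝ) 1)]
          apply Units.ext
          rw [hθ, coe_circleDiagonal]
          ext i j
          fin_cases i; fin_cases j
          simp [Circle.coe_exp]
      rw [hw, hcomp k, hk', hz]
      exact (congrArg Subtype.val (gprimeBlock_eq_relabel_circleDiagonal L α hw₀ (fun _ => (![0, θ, 0] : Fin 3 → ℝ)))).symm
    · exact exists_coe_eq_gprimeBlock_of_commute L α S' hα hS' p w (hreg w hw) (hregS w) _ (hkw w)
  -- the chart torus, read through `π_B`
  have hiff : ∀ g : ↥M', (g : G) ∈ chartTorusG L α S' ↔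
      ((πB g : ↥(unitaryGroupOfForm (starRingEnd ℂ) ((Matrix.diagonal ![(α ∘ τ₀) 0, (α ∘ τ₀) 2]).map w₀.1.embedding))) : GL (Fin 2) ℂ) ∈
        Set.range (circleDiagonal 2) := by
    intro g
    constructor
    · intro hg
      -- the closed set `D = {g ∈ M′ | π_B g unit diagonal}` pushed into `G` contains the chart points, hence their closure `T′`
      have hD : IsClosed {g : ↥M' | ((πB g : ↥(unitaryGroupOfForm (starRingEnd ℂ) ((Matrix.diagonal ![(α ∘ τ₀) 0, (α ∘ τ₀) 2]).map w₀.1.embedding))) :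
          GL (Fin 2) ℂ) ∈ Set.range (circleDiagonal 2)} :=
        ((isCompact_range (continuous_circleDiagonal 2)).isClosed).preimage (continuous_subtype_val.comp hπB_cont)
      have hM'closed : IsClosed ((M' : Subgroup G) : Set G) := by
        have h : ((M' : Subgroup G) : Set G) = {g : G | g * gprimeTorus L α S' p = gprimeTorus L α S' p * g} := by
          ext g; exact Subgroup.mem_centralizer_singleton_iff
        rw [h]
        exact isClosed_eq (continuous_id.mul continuous_const) (continuous_const.mul continuous_id)
      have hE : IsClosed (((↑) : ↥M' → G) '' {g : ↥M' | ((πB g : ↥(unitaryGroupOfForm (starRingEnd ℂ) ((Matrix.diagonal ![(α ∘ τ₀) 0, (α ∘ τ₀) 2]).map w₀.1.embedding))) :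
          GL (Fin 2) ℂ) ∈ Set.range (circleDiagonal 2)}) :=
        hM'closed.isClosedEmbedding_subtypeVal.isClosedMap _ hD
      have hsub : ((gprimeTorusHom L α S').range : Set G) ⊆ ((↑) : ↥M' → G) '' {g : ↥M' |
          ((πB g : ↥(unitaryGroupOfForm (starRingEnd ℂ) ((Matrix.diagonal ![(α ∘ τ₀) 0, (α ∘ τ₀) 2]).map w₀.1.embedding))) : GL (Fin 2) ℂ) ∈
            Set.range (circleDiagonal 2)} := by
        rintro _ ⟨c, rfl⟩
        refine ⟨⟨gprimeTorus L α S' (Multiplicative.toAdd c), gprimeTorus_mem_centralizer L α S' p _⟩, ⟨![Circle.exp ((Multiplicative.toAdd c) w₀ 0),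
          Circle.exp ((Multiplicative.toAdd c) w₀ 2)], ?_⟩, rfl⟩
        show _ = ((π _).1 : GL (Fin 2) ℂ)
        rw [htorus]
      have hcl : (chartTorusG L α S' : Set G) ⊆ ((↑) : ↥M' → G) '' {g : ↥M' |
          ((πB g : ↥(unitaryGroupOfForm (starRingEnd ℂ) ((Matrix.diagonal ![(α ∘ τ₀) 0, (α ∘ τ₀) 2]).map w₀.1.embedding))) : GL (Fin 2) ℂ) ∈
            Set.range (circleDiagonal 2)} := by
        show ((gprimeTorusHom L α S').range.topologicalClosure : Set G) ⊆ _
        rw [Subgroup.topologicalClosure_coe]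
        exact closure_minimal hsub hE
      obtain ⟨g', hg', hgg'⟩ := hcl hg
      have : g' = g := Subtype.ext hgg'
      rw [← this]
      exact hg'
    · rintro ⟨u, hu⟩
      -- `g = s_B(π_B g) · k` with `k ∈ K ≤ T′` and `s_B(π_B g)` a chart point
      have hg : (g : G) = ((sB (πB g) : ↥M') : G) * (((sB (πB g))⁻¹ * g : ↥M') : G) := by
        rw [← Subgroup.coe_mul, mul_inv_cancel_left]
      rw [hg]
      refine Subgroup.mul_mem _ ?_ (hKT _ (hsec g))
      rw [hsB_coe]
      obtain ⟨θ₀, hθ₀⟩ := Circle.exp_surjective (u 0)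
      obtain ⟨θ₁, hθ₁⟩ := Circle.exp_surjective (u 1)
      refine mem_T_of_local _ fun w => ?_
      by_cases hw : w = w₀
      · refine ⟨![θ₀, 0, θ₁], ?_⟩
        have hz : ι (πB g, 1) =
            ⟨circleDiagonal 3 (fun i => Circle.exp ((![θ₀, 0, θ₁] : Fin 3 → ℝ) i)), circleDiagonal_mem_archLocal_diagonal L 3 (α ∘ τ₀) w₀ _⟩ := by
          rw [circleDiagonal_eq_endoEmb L (α ∘ τ₀) w₀ (fun i => Circle.exp ((![θ₀, 0, θ₁] : Fin 3 → ℝ) i))]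
          congr 1
          refine Prod.ext (Subtype.ext ?_) (Subtype.ext ?_)
          · show ((πB g : ↥(unitaryGroupOfForm (starRingEnd ℂ) ((Matrix.diagonal ![(α ∘ τ₀) 0, (α ∘ τ₀) 2]).map w₀.1.embedding))) : GL (Fin 2) ℂ) =
              circleDiagonal 2 ![Circle.exp ((![θ₀, 0, θ₁] : Fin 3 → ℝ) 0), Circle.exp ((![θ₀, 0, θ₁] : Fin 3 → ℝ) 2)]
            rw [← hu]
            have h0 : (![θ₀, 0, θ₁] : Fin 3 → ℝ) 0 = θ₀ := rfl
            have h2 : (![θ₀, 0, θ₁] : Fin 3 → ℝ) 2 = θ₁ := rfl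
            rw [h0, h2, hθ₀, hθ₁]
            congr 1
            funext i; fin_cases i <;> rfl
          · show ((1 : ↥(unitaryGroupOfForm (starRingEnd ℂ) ((Matrix.diagonal ![(α ∘ τ₀) 1]).map w₀.1.embedding))) : GL (Fin 1) ℂ) =
              circleDiagonal 1 ![Circle.exp ((![θ₀, 0, θ₁] : Fin 3 → ℝ) 1)]
            have h1 : (![θ₀, 0, θ₁] : Fin 3 → ℝ) 1 = 0 := rfl
            rw [h1, Circle.exp_zero]
            have h11 : (![(1 : Circle)] : Fin 1 → Circle) = 1 := by funext i; fin_cases i; rfl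
            rw [h11, map_one]
            rfl
        rw [hw, hj_w₀, hz]
        exact (congrArg Subtype.val (gprimeBlock_eq_relabel_circleDiagonal L α hw₀ (fun _ => (![θ₀, 0, θ₁] : Fin 3 → ℝ)))).symm
      · refine ⟨0, ?_⟩
        rw [hj_ne _ w hw, ← hΦγ (fun _ => (0 : Fin 3 → ℝ)) w]
        have h0 : gprimeTorus L α S' (fun _ => (0 : Fin 3 → ℝ)) = 1 := gprimeTorus_zero L α S'
        rw [h0, map_one]
        rfl
  -- the `K`-component of a chart point: zero the block slots at `w₀`
  have hsnd : ∀ c : {w : InfinitePlace L // IsComplex w} → Fin 3 → ℝ,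
      (((sB (πB ⟨gprimeTorus L α S' c, gprimeTorus_mem_centralizer L α S' p c⟩))⁻¹ * ⟨gprimeTorus L α S' c, gprimeTorus_mem_centralizer L α S' p c⟩ : ↥M') : G) =
        gprimeTorus L α S' (Function.update c w₀ ![0, c w₀ 1, 0]) := by
    intro c
    have hmem' : gprimeTorus L α S' (Function.update c w₀ ![0, c w₀ 1, 0]) ∈ M' := gprimeTorus_mem_centralizer L α S' p _
    have hupd : Function.update c w₀ ![0, c w₀ 1, 0] w₀ = ![0, c w₀ 1, 0] := Function.update_self _ _ _
    have hprod : (⟨gprimeTorus L α S' c, gprimeTorus_mem_centralizer L α S' p c⟩ : ↥M') =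
        sB (πB ⟨gprimeTorus L α S' c, gprimeTorus_mem_centralizer L α S' p c⟩) * ⟨_, hmem'⟩ := by
      apply Subtype.ext
      show gprimeTorus L α S' c = j (πB ⟨gprimeTorus L α S' c, _⟩) * gprimeTorus L α S' (Function.update c w₀ ![0, c w₀ 1, 0])
      apply Φ.injective
      funext w
      rw [map_mul, Pi.mul_apply, hΦγ, hΦγ]
      by_cases hw : w = w₀
      · rw [hw, hj_w₀, hπB_apply, htorus, hblk c, hblk (Function.update c w₀ ![0, c w₀ 1, 0]), ← map_mul eτ]
        congr 1
        rw [circleDiagonal_eq_endoEmb L (α ∘ τ₀) w₀ (fun k => Circle.exp (c w₀ k)),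
          circleDiagonal_eq_endoEmb L (α ∘ τ₀) w₀ (fun k => Circle.exp (Function.update c w₀ ![0, c w₀ 1, 0] w₀ k)), ← map_mul ι]
        congr 1
        simp only [hupd]
        refine Prod.ext (Subtype.ext ?_) (Subtype.ext ?_)
        · show circleDiagonal 2 ![Circle.exp (c w₀ 0), Circle.exp (c w₀ 2)] =
            circleDiagonal 2 ![Circle.exp (c w₀ 0), Circle.exp (c w₀ 2)] * circleDiagonal 2 ![Circle.exp ((![0, c w₀ 1, 0] : Fin 3 → ℝ) 0), Circle.exp ((![0, c w₀ 1, 0] : Fin 3 → ℝ) 2)]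
          have h0 : (![0, c w₀ 1, 0] : Fin 3 → ℝ) 0 = 0 := rfl
          have h2 : (![0, c w₀ 1, 0] : Fin 3 → ℝ) 2 = 0 := rfl
          rw [h0, h2, Circle.exp_zero]
          have h11 : (![(1 : Circle), 1] : Fin 2 → Circle) = 1 := by funext i; fin_cases i <;> rfl
          rw [h11, map_one, mul_one]
        · show circleDiagonal 1 ![Circle.exp (c w₀ 1)] = 1 * circleDiagonal 1 ![Circle.exp ((![0, c w₀ 1, 0] : Fin 3 → ℝ) 1)]
          rw [one_mul]
          rfl
      · rw [hj_ne _ w hw, one_mul]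
        exact gprimeBlock_congr_place L α S' w (Function.update_of_ne hw ![0, c w₀ 1, 0] c).symm
    calc (((sB (πB ⟨gprimeTorus L α S' c, gprimeTorus_mem_centralizer L α S' p c⟩))⁻¹ *
            ⟨gprimeTorus L α S' c, gprimeTorus_mem_centralizer L α S' p c⟩ : ↥M') : G)
        = (((sB (πB ⟨gprimeTorus L α S' c, gprimeTorus_mem_centralizer L α S' p c⟩))⁻¹ *
            (sB (πB ⟨gprimeTorus L α S' c, gprimeTorus_mem_centralizer L α S' p c⟩) * ⟨_, hmem'⟩) : ↥M') : G) := by rw [← hprod]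
      _ = gprimeTorus L α S' (Function.update c w₀ ![0, c w₀ 1, 0]) := by rw [inv_mul_cancel_left]
  -- §G  Assembly.
  refine ⟨K, e, ?_, hKT, ?_, hiff, ?_, hsnd, ?_⟩
  · -- `K` is closed
    show IsClosed ((πB.ker : Subgroup ↥M') : Set ↥M')
    rw [MonoidHom.coe_ker]
    exact isClosed_singleton.preimage hπB_cont
  · -- `K` is commutative (it sits in the abelian `T′`)
    intro k₁ hk₁ k₂ hk₂
    have h := chartTorusG_mul_comm L α S' ⟨(k₁ : G), hKT k₁ hk₁⟩ ⟨(k₂ : G), hKT k₂ hk₂⟩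
    have h' : (k₁ : G) * (k₂ : G) = (k₂ : G) * (k₁ : G) := congrArg Subtype.val h
    exact Subtype.ext h'
  · -- the block of a chart point
    intro c
    show (((π ⟨gprimeTorus L α S' c, gprimeTorus_mem_centralizer L α S' p c⟩).1 :
        ↥(unitaryGroupOfForm (starRingEnd ℂ) ((Matrix.diagonal ![(α ∘ τ₀) 0, (α ∘ τ₀) 2]).map w₀.1.embedding))) : GL (Fin 2) ℂ) =
      circleDiagonal 2 ![Circle.exp (c w₀ 0), Circle.exp (c w₀ 2)]
    rw [htorus]
  · -- `e_M(T′) = A × ⊤` as subgroups of `B × K`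
    ext q
    simp only [Subgroup.mem_map, Subgroup.mem_subgroupOf, Subgroup.mem_prod, Subgroup.mem_top, and_true, MonoidHom.mem_range,
      MonoidHom.coe_coe]
    constructor
    · rintro ⟨g, hg, rfl⟩
      obtain ⟨u, hu⟩ := (hiff g).1 hg
      exact ⟨u, Subtype.ext hu⟩
    · rintro ⟨u, hu⟩
      refine ⟨e.symm q, (hiff _).2 ⟨u, ?_⟩, e.apply_symm_apply q⟩
      have h1 : πB (e.symm q) = q.1 := by
        show (e (e.symm q)).1 = q.1
        rw [e.apply_symm_apply]
      rw [h1, ← hu]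
      rfl

end Local

end Literature.NumberTheory.Automorphic.UnitaryGroup

end
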